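import Summits.Ventures.DiscreteObjects.PP12.OrderElevenHomologyKernel

/-!
# PP(12), order-11 cell, Case A: KERNEL FUNCTIONS of the blocking certificate, part 2 — the completeness WALKER (designs g22)
Framing: lottery ticket; floor = certified bounds/negative ranges.

Cell pub-namedobj (venture DiscreteObjects), target (M), P11-SIZING.md. `walk i f j usedV usedD pv rest` explores, column by column (`j, j+1, …`, fuel `f`,
skipping the hole `i`), every prefix of a row of index `i` that is injective (`usedV` = values used) and whose differences with row `0 = (·,0,1,…,10)` on the
columns `≥ 1` are non-zero and unused (`usedD`); `pv` is the packed prefix (base 16). At a complete row it CONSUMES the head of the literal list `rest` if it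
equals the packed row (else fails). Since the walk visits rows in increasing lexicographic order of `(r_0, r_1, …)` — the order of `CANDS2` / `CANDS3`
(`OrderElevenHomologyData`) — `walk i 12 0 0 0 0 CANDSᵢ = some []` certifies that the list is EXACTLY the admissible rows; the run files split the walk by the
first digit (`walkFrom`). Soundness (every row `1` / `2` of a normal array is listed) follows in a later file. No `sorry`, no axioms; nothing here asserts a census statement.
-/

set_option maxRecDepth 100000

namespace Summit.Ventures.DiscreteObjects.PP12

namespace Homology12

/-- one value `v` at column `j`: skip it (`some rest`) if the value is used or its difference with row `0` is zero or used; otherwise descend with the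
continuation `W usedV' usedD' pv'` -/
def stepV (j usedV usedD pv : ℕ) (W : ℕ → ℕ → ℕ → List ℕ → Option (List ℕ)) (v : ℕ) (rest : List ℕ) : Option (List ℕ) :=
  if usedV.testBit v then some rest
  else if j == 0 then W (usedV ||| (1 <<< v)) usedD (pv + v * 16 ^ j) rest
  else if ((v + 11 - (j - 1)) % 11 == 0) || usedD.testBit ((v + 11 - (j - 1)) % 11) then some rest
  else W (usedV ||| (1 <<< v)) (usedD ||| (1 <<< ((v + 11 - (j - 1)) % 11))) (pv + v * 16 ^ j) rest

/-- try the values `v = 11 − n, …, 10` at column `j` (ascending), threading the literal list -/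
def walkV (j usedV usedD pv : ℕ) (W : ℕ → ℕ → ℕ → List ℕ → Option (List ℕ)) : ℕ → List ℕ → Option (List ℕ)
  | 0, rest => some rest
  | c + 1, rest =>
    match stepV j usedV usedD pv W (10 - c) rest with
    | none => none
    | some rest' => walkV j usedV usedD pv W c rest'

/-- **the walker** over the admissible rows of index `i` (columns `j …`, fuel `f`), consuming the literal list at complete rows -/
def walk (i : ℕ) : ℕ → ℕ → ℕ → ℕ → ℕ → List ℕ → Option (List ℕ)
  | 0, _, _, _, pv, rest =>
    match rest with
    | [] => none
    | x :: rest' => if x == pv then some rest' else none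
  | f + 1, j, usedV, usedD, pv, rest =>
    if j == i then walk i f (j + 1) usedV usedD pv rest
    else walkV j usedV usedD pv (walk i f (j + 1)) 11 rest

/-- `Option (List ℕ)` equality test (kernel-friendly) -/
def isSomeNil : Option (List ℕ) → Bool
  | some [] => true
  | _ => false

/-- the walk of index `i` restricted to first digit `v₀` (column `0` carries no difference condition), over the literal slice `L`: succeeds iff it consumes `L` exactly -/
def walkFrom (i v0 : ℕ) (L : List ℕ) : Bool := isSomeNil (walk i 11 1 (1 <<< v0) 0 v0 L)

end Homology12

end Summit.Ventures.DiscreteObjects.PP12
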